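import Mathlib

/-!
# `SpinFreezing` — negative lemma: the rev-14 analytic label block does not freeze the spin

Route `RecedingSphereBudgets`, crux `SpinFreezing` (item stmt-FinalStateConjecture-17687, rank 4),
refuter crux-attack (refuter-rattack-stmt-FinalStateConjecture-17687-0, 2026-08-17). Nothing in this
file asserts the crux: it is a LOAD-BEARING lemma for provers and planners (no definitions, no facts).

The hypothesis package Q′ of `SpinFreezing` constrains a spin label `aᵢ : ℝ → ℝ` *analytically* only
through the clause
`ContDiff ℝ ⊤ (M i) ∧ ContDiff ℝ ⊤ (a i) ∧ (∀ t, m₀ ≤ M i t ∧ M i t ≤ m₀⁻¹ ∧ |a i t| ≤ χ * M i t) ∧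
 ∀ n ≥ 1, iteratedDeriv n (M i) → 0 ∧ iteratedDeriv n (a i) → 0`
(rev 14 raised `a′, a″ → 0` to ALL derivatives). `spinFreezing_labelBlock_insufficient` shows that
this block — even together with the conclusion of the sibling crux `MassFreezing` (the mass label
converges) — does NOT imply the conclusion `∃ aᵢ∞, aᵢ → aᵢ∞` of `SpinFreezing`: witness `m₀ = χ = 1/2`,
`M ≡ 2`, `a t = Re (t + i)^i = e^{-arg(t+i)} cos(log ‖t + i‖)` (principal branch; `t + i` never meets
the cut), whose `n`-th derivative is `Re[i(i−1)⋯(i−n+1)(t+i)^{i−n}] = O(t^{−n})` while `a` takes the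
values `± e^{-arg(t+i)}`, of modulus `≥ e^{−π}`, along `‖t + i‖ = e^{2πk}`, `e^{2πk+π}`. Hence every
proof of `SpinFreezing` must use the GEOMETRIC clauses of Q′ (collar `C^k` convergence and
`O`-scoping feeding a budget or the second law, cf. `Cruxes/SpinFreezing/Lines/birth.lean`); the
analytic block alone is decoration for the conclusion. Terms used below (no declarations):
`c_n = ∏_{j<n} (i − j)`, `G_n(t) = c_n (t + i)^{i−n}`, `a(t) = Re (t + i)^i`, sample points
`√(u² − 1)` with `‖√(u²−1) + i‖ = u`.
-/

-- every `Summit.FinalStateConjecture.FinalStateConjecture.…` name repeats the summit = sub-problem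
-- segment (D-0017 layout, CONVENTIONS §2; lakefile sets it for the library build, a standalone
-- elaboration of this file does not see that option); the duplicate is deliberate.
set_option linter.dupNamespace false

noncomputable section

open Filter Topology Complex
open scoped BigOperators

namespace Summit.FinalStateConjecture.FinalStateConjecture.Theorems.SpinFreezing.Negative

/-- `‖t + i‖ = √(t² + 1)`. [folklore] -/
theorem norm_ofReal_add_I (t : ℝ) : ‖(t : ℂ) + I‖ = √(t ^ 2 + 1) := by
  simpa using norm_add_mul_I t 1

/-- Chain rule: `d/dt (t + i)^c = c (t + i)^{c − 1}` along the real line (`t + i` lies in the slit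
plane). [folklore] -/
theorem hasDerivAt_cpow_affine (c : ℂ) (t : ℝ) :
    HasDerivAt (fun s : ℝ ↦ ((s : ℂ) + I) ^ c) (c * ((t : ℂ) + I) ^ (c - 1)) t := by
  have hs : (t : ℂ) + I ∈ slitPlane := by
    rw [mem_slitPlane_iff]
    right
    simp
  have h : HasDerivAt (fun z : ℂ ↦ (z + I) ^ c) (c * ((t : ℂ) + I) ^ (c - 1) * 1) (t : ℂ) :=
    ((hasDerivAt_id (t : ℂ)).add_const I).cpow_const hs
  simpa using h.comp_ofReal

/-- `G_n' = G_{n+1}` for `G_n(t) = c_n (t + i)^{i − n}`, `c_n = ∏_{j<n} (i − j)`. [folklore] -/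
theorem hasDerivAt_G (n : ℕ) (t : ℝ) :
    HasDerivAt (fun s : ℝ ↦ (∏ j ∈ Finset.range n, (I - (j : ℂ))) * ((s : ℂ) + I) ^ (I - n))
      ((∏ j ∈ Finset.range (n + 1), (I - (j : ℂ))) * ((t : ℂ) + I) ^ (I - ((n + 1 : ℕ) : ℂ)))
      t := by
  have h := (hasDerivAt_cpow_affine (I - n) t).const_mul (∏ j ∈ Finset.range n, (I - (j : ℂ)))
  have he : (I - ((n + 1 : ℕ) : ℂ)) = I - n - 1 := by
    push_cast
    ring
  have hval : (∏ j ∈ Finset.range (n + 1), (I - (j : ℂ))) * ((t : ℂ) + I) ^ (I - n - 1) =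
      (∏ j ∈ Finset.range n, (I - (j : ℂ))) * ((I - n) * ((t : ℂ) + I) ^ (I - n - 1)) := by
    rw [Finset.prod_range_succ]
    ring
  rw [he, hval]
  exact h

/-- `(Re ∘ G_n)' = Re ∘ G_{n+1}`. [folklore] -/
theorem hasDerivAt_re_G (n : ℕ) (t : ℝ) :
    HasDerivAt
      (fun s : ℝ ↦ ((∏ j ∈ Finset.range n, (I - (j : ℂ))) * ((s : ℂ) + I) ^ (I - n)).re)
      ((∏ j ∈ Finset.range (n + 1), (I - (j : ℂ))) * ((t : ℂ) + I) ^ (I - ((n + 1 : ℕ) : ℂ))).re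
      t := by
  have h := reCLM.hasFDerivAt.comp_hasDerivAt t (hasDerivAt_G n t)
  simpa [Function.comp_def] using h

/-- Closed form of all derivatives of the spin label `a = Re (t + i)^i`: `a^{(n)} = Re ∘ G_n`.
[folklore] -/
theorem iteratedDeriv_spinLabel (n : ℕ) :
    iteratedDeriv n (fun t : ℝ ↦ (((t : ℂ) + I) ^ I).re) =
      fun t : ℝ ↦ ((∏ j ∈ Finset.range n, (I - (j : ℂ))) * ((t : ℂ) + I) ^ (I - n)).re := by
  induction n with
  | zero =>
    funext t
    simp
  | succ n ih =>
    rw [iteratedDeriv_succ, ih]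
    funext t
    exact (hasDerivAt_re_G n t).deriv

/-- The spin label is smooth. [folklore] -/
theorem contDiff_spinLabel : ContDiff ℝ (⊤ : ℕ∞) (fun t : ℝ ↦ (((t : ℂ) + I) ^ I).re) := by
  refine contDiff_of_differentiable_iteratedDeriv fun m _ ↦ ?_
  rw [iteratedDeriv_spinLabel]
  exact fun t ↦ (hasDerivAt_re_G m t).differentiableAt

/-- `‖(t + i)^{i − n}‖ ≤ ‖t + i‖^{−n}` (the factor `e^{−arg(t+i)}` is at most `1`). [folklore] -/
theorem norm_cpow_I_sub_le (n : ℕ) (t : ℝ) :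
    ‖((t : ℂ) + I) ^ (I - n)‖ ≤ (‖(t : ℂ) + I‖ ^ n)⁻¹ := by
  have hne : (t : ℂ) + I ≠ 0 := fun h ↦ by simpa using congrArg Complex.im h
  rw [norm_cpow_of_ne_zero hne]
  have hre : (I - (n : ℂ)).re = -n := by simp
  have him : (I - (n : ℂ)).im = 1 := by simp
  rw [hre, him, mul_one, Real.rpow_neg (norm_nonneg _), Real.rpow_natCast]
  refine div_le_self (by positivity) ?_
  have harg : 0 ≤ arg ((t : ℂ) + I) := by
    rw [arg_nonneg_iff]
    simp
  exact Real.one_le_exp harg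

/-- Decay of the derivatives: `‖G_n t‖ ≤ ‖c_n‖ / t` for `n ≥ 1`, `t ≥ 1`. [folklore] -/
theorem norm_G_le {n : ℕ} (hn : 1 ≤ n) {t : ℝ} (ht : 1 ≤ t) :
    ‖(∏ j ∈ Finset.range n, (I - (j : ℂ))) * ((t : ℂ) + I) ^ (I - n)‖ ≤
      ‖∏ j ∈ Finset.range n, (I - (j : ℂ))‖ * t⁻¹ := by
  have ht' : t ≤ ‖(t : ℂ) + I‖ := by
    rw [norm_ofReal_add_I]
    calc t = √(t ^ 2) := (Real.sqrt_sq (by linarith)).symm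
      _ ≤ √(t ^ 2 + 1) := Real.sqrt_le_sqrt (by linarith)
  have h1 : 1 ≤ ‖(t : ℂ) + I‖ := ht.trans ht'
  have hpow : t ≤ ‖(t : ℂ) + I‖ ^ n := ht'.trans (le_self_pow₀ h1 (by omega))
  rw [norm_mul]
  refine mul_le_mul_of_nonneg_left ((norm_cpow_I_sub_le n t).trans ?_) (norm_nonneg _)
  exact inv_anti₀ (by linarith) hpow

/-- All derivatives of order `≥ 1` of the spin label tend to `0`. [folklore] -/
theorem tendsto_iteratedDeriv_spinLabel {n : ℕ} (hn : 1 ≤ n) :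
    Tendsto (iteratedDeriv n (fun t : ℝ ↦ (((t : ℂ) + I) ^ I).re)) atTop (𝓝 0) := by
  rw [iteratedDeriv_spinLabel]
  have hlim : Tendsto (fun t : ℝ ↦ ‖∏ j ∈ Finset.range n, (I - (j : ℂ))‖ * t⁻¹) atTop (𝓝 0) := by
    simpa using tendsto_inv_atTop_zero.const_mul ‖∏ j ∈ Finset.range n, (I - (j : ℂ))‖
  refine squeeze_zero_norm' ?_ hlim
  filter_upwards [eventually_ge_atTop (1 : ℝ)] with t ht
  rw [Real.norm_eq_abs]
  exact (abs_re_le_norm _).trans (norm_G_le hn ht)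

/-- The spin label is bounded by `1`. [folklore] -/
theorem abs_spinLabel_le_one (t : ℝ) : |(((t : ℂ) + I) ^ I).re| ≤ 1 := by
  have h : ‖((t : ℂ) + I) ^ I‖ ≤ 1 := by
    have h0 := norm_cpow_I_sub_le 0 t
    simpa using h0
  exact (abs_re_le_norm _).trans h

/-- Polar form of the spin label: `Re (t + i)^i = e^{−arg(t+i)} cos(log ‖t + i‖)`. [folklore] -/
theorem spinLabel_eq (t : ℝ) :
    (((t : ℂ) + I) ^ I).re = Real.exp (-arg ((t : ℂ) + I)) * Real.cos (Real.log ‖(t : ℂ) + I‖) := by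
  have hne : (t : ℂ) + I ≠ 0 := fun h ↦ by simpa using congrArg Complex.im h
  rw [cpow_def_of_ne_zero hne, exp_re]
  simp [Complex.log_re, Complex.log_im]

/-- `‖√(u² − 1) + i‖ = u` for `u ≥ 1`. [folklore] -/
theorem norm_samplePt_add_I {u : ℝ} (hu : 1 ≤ u) : ‖((√(u ^ 2 - 1) : ℝ) : ℂ) + I‖ = u := by
  rw [norm_ofReal_add_I, Real.sq_sqrt (by nlinarith), sub_add_cancel, Real.sqrt_sq (by linarith)]

/-- `√(u² − 1) ≥ u − 1` for `u ≥ 1`. [folklore] -/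
theorem sub_one_le_samplePt {u : ℝ} (hu : 1 ≤ u) : u - 1 ≤ √(u ^ 2 - 1) := by
  rw [Real.le_sqrt (by linarith) (by nlinarith)]
  nlinarith

/-- The spin label at the sample points `‖t + i‖ = e^x`, `x ≥ 0`: `e^{−arg} cos x`. [folklore] -/
theorem spinLabel_samplePt {x : ℝ} (hx : 0 ≤ x) :
    ((((√(Real.exp x ^ 2 - 1) : ℝ) : ℂ) + I) ^ I).re =
      Real.exp (-arg (((√(Real.exp x ^ 2 - 1) : ℝ) : ℂ) + I)) * Real.cos x := by
  rw [spinLabel_eq, norm_samplePt_add_I (Real.one_le_exp hx), Real.log_exp]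

/-- The sample points along `x_k = k·2π + θ` (`θ ≥ 0`) run off to `+∞`. [folklore] -/
theorem tendsto_samplePt {θ : ℝ} (hθ : 0 ≤ θ) :
    Tendsto (fun k : ℕ ↦ √(Real.exp (k * (2 * Real.pi) + θ) ^ 2 - 1)) atTop atTop := by
  have hlin : Tendsto (fun k : ℕ ↦ (k : ℝ) * (2 * Real.pi) + θ - 1) atTop atTop := by
    refine tendsto_atTop_add_const_right _ _ (tendsto_atTop_add_const_right _ _ ?_)
    exact Tendsto.atTop_mul_const (show (0 : ℝ) < 2 * Real.pi by positivity)
      tendsto_natCast_atTop_atTop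
  refine tendsto_atTop_mono (fun k ↦ ?_) hlin
  have hk : 0 ≤ (k : ℝ) * (2 * Real.pi) + θ := by positivity
  calc (k : ℝ) * (2 * Real.pi) + θ - 1 ≤ Real.exp ((k : ℝ) * (2 * Real.pi) + θ) - 1 := by
        linarith [Real.add_one_le_exp ((k : ℝ) * (2 * Real.pi) + θ)]
    _ ≤ √(Real.exp ((k : ℝ) * (2 * Real.pi) + θ) ^ 2 - 1) :=
        sub_one_le_samplePt (Real.one_le_exp hk)

/-- The spin label has no limit at `+∞`: it is `≥ e^{−π}` along `‖t+i‖ = e^{2πk}` and `≤ −e^{−π}`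
along `‖t+i‖ = e^{2πk+π}`. [folklore] -/
theorem not_tendsto_spinLabel :
    ¬ ∃ l : ℝ, Tendsto (fun t : ℝ ↦ (((t : ℂ) + I) ^ I).re) atTop (𝓝 l) := by
  rintro ⟨l, hl⟩
  have hc : 0 < Real.exp (-Real.pi) := Real.exp_pos _
  have hexp : ∀ t : ℝ, Real.exp (-Real.pi) ≤ Real.exp (-arg ((t : ℂ) + I)) := fun t ↦
    Real.exp_le_exp.2 (neg_le_neg (arg_le_pi _))
  -- along x_k = k·2π the label is ≥ e^{−π}
  have h₁ : Real.exp (-Real.pi) ≤ l := by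
    refine ge_of_tendsto' (hl.comp (tendsto_samplePt le_rfl)) fun k ↦ ?_
    have hk : 0 ≤ (k : ℝ) * (2 * Real.pi) + 0 := by positivity
    simp only [Function.comp_apply]
    rw [spinLabel_samplePt hk, add_zero, Real.cos_nat_mul_two_pi, mul_one]
    exact hexp _
  -- along x_k = k·2π + π the label is ≤ −e^{−π}
  have h₂ : l ≤ -Real.exp (-Real.pi) := by
    refine le_of_tendsto' (hl.comp (tendsto_samplePt Real.pi_pos.le)) fun k ↦ ?_
    have hk : 0 ≤ (k : ℝ) * (2 * Real.pi) + Real.pi := by positivity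
    simp only [Function.comp_apply]
    rw [spinLabel_samplePt hk, Real.cos_nat_mul_two_pi_add_pi, mul_neg_one]
    exact neg_le_neg (hexp _)
  linarith

/-- **The analytic label block of Q′ does not freeze the spin** (load-bearing lemma for
`RecedingSphereBudgets.SpinFreezing`, stmt-FinalStateConjecture-17687): there are `m₀, χ` and smooth
labels `M, a` satisfying the box `m₀ ≤ M ≤ m₀⁻¹`, `|a| ≤ χ M`, with ALL derivatives of order `≥ 1`
tending to `0` and the mass label convergent (the conclusion of `MassFreezing`), whose spin label
has no limit. Witness `m₀ = χ = 1/2`, `M ≡ 2`, `a = Re (t + i)^i`. [folklore] -/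
theorem spinFreezing_labelBlock_insufficient :
    ∃ (m₀ χ : ℝ) (M a : ℝ → ℝ), (0 < m₀ ∧ 0 ≤ χ ∧ χ < 1) ∧
      ContDiff ℝ (⊤ : ℕ∞) M ∧ ContDiff ℝ (⊤ : ℕ∞) a ∧
      (∀ t, m₀ ≤ M t ∧ M t ≤ m₀⁻¹ ∧ |a t| ≤ χ * M t) ∧
      (∀ n : ℕ, 1 ≤ n →
        Tendsto (iteratedDeriv n M) atTop (𝓝 0) ∧ Tendsto (iteratedDeriv n a) atTop (𝓝 0)) ∧
      (∃ Mi : ℝ, Tendsto M atTop (𝓝 Mi)) ∧ ¬ ∃ ai : ℝ, Tendsto a atTop (𝓝 ai) := by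
  refine ⟨1 / 2, 1 / 2, fun _ ↦ 2, fun t : ℝ ↦ (((t : ℂ) + I) ^ I).re,
    ⟨by norm_num, by norm_num, by norm_num⟩, contDiff_const, contDiff_spinLabel,
    fun t ↦ ⟨by norm_num, by norm_num, ?_⟩,
    fun n hn ↦ ⟨?_, tendsto_iteratedDeriv_spinLabel hn⟩, ⟨2, tendsto_const_nhds⟩,
    not_tendsto_spinLabel⟩
  · have := abs_spinLabel_le_one t
    linarith
  · have h0 : iteratedDeriv n (fun _ : ℝ ↦ (2 : ℝ)) = fun _ ↦ 0 := by
      funext x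
      rw [iteratedDeriv_const]
      simp [show n ≠ 0 by omega]
    rw [h0]
    exact tendsto_const_nhds

/-- Corollary in `¬ ∀` form: the "labels-only" reading of `SpinFreezing` (analytic label block of Q′
for one hole plus the conclusion of `MassFreezing` ⟹ spin convergence) is FALSE. [folklore] -/
theorem not_spinFreezing_labelsOnly :
    ¬ ∀ (m₀ χ : ℝ) (M a : ℝ → ℝ), (0 < m₀ ∧ 0 ≤ χ ∧ χ < 1) →
      ContDiff ℝ (⊤ : ℕ∞) M → ContDiff ℝ (⊤ : ℕ∞) a →
      (∀ t, m₀ ≤ M t ∧ M t ≤ m₀⁻¹ ∧ |a t| ≤ χ * M t) →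
      (∀ n : ℕ, 1 ≤ n →
        Tendsto (iteratedDeriv n M) atTop (𝓝 0) ∧ Tendsto (iteratedDeriv n a) atTop (𝓝 0)) →
      (∃ Mi : ℝ, Tendsto M atTop (𝓝 Mi)) → ∃ ai : ℝ, Tendsto a atTop (𝓝 ai) := by
  intro h
  obtain ⟨m₀, χ, M, a, hbox, hM, ha, hb, hd, hMi, hna⟩ := spinFreezing_labelBlock_insufficient
  exact hna (h m₀ χ M a hbox hM ha hb hd hMi)

end Summit.FinalStateConjecture.FinalStateConjecture.Theorems.SpinFreezing.Negative

end
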